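import Literature.Probability.LatticeModels.IsingLaceCoefficients
import Literature.Combinatorics.SimpleGraph.SeparatingBridges
import HarnessLib

/-!
# The first pivotal bond of a current: Sakai's decomposition (2.9)

Topic `Probability/LatticeModels`, grouping namespace `IsingLace`; the currents side of
`Literature/Combinatorics/SimpleGraph/SeparatingBridges.lean`. For a current `N` on a finite
graph `G`, the percolation-type predicates of Sakai 2007, Definition 2.1 (`IsingLace.Conn`,
`ConnOff`, `clusterOff`, `ConnAvoid`, `IsPivotal`, `IsDoublyConn` of `IsingLaceCoefficients.lean`)
are identified with the graph-theoretic notions of the trace graph `T_N = openGraph N.traced`: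
setting `n_b = 0` deletes the edge `b` from the trace graph (`openGraph_traced_update_zero`), the
cluster `𝒞^b_N(x)` is the `x`-side of `b` (`mem_clusterOff_iff`), "`w ⟷_N x in Sᶜ`" is a walk
of the trace graph staying off `S` (`connAvoid_iff_exists_walk`), and **double connection is
`2`-edge-reachability** (`isDoublyConn_iff`: a pivotal directed bond is exactly a separating edge
oriented near-to-far). Consequently the qualifying bonds of Sakai's first expansion step — the
directed bonds `b` with `o ⟺_N b̲ off b`, `n_b > 0`, `b̄ ⟷_N x in 𝒞^b_N(o)ᶜ` (`IsFirstPivotal`) —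
are the first darts of the trace graph (`isFirstPivotal_iff`), whence **the indicator identity
(2.9)**: `1{o ⟷_N x} = 1{o ⟺_N x} + Σ_b 1{o ⟺_N b̲ off b} 1{n_b > 0} 1{b̄ ⟷_N x in 𝒞^b_N(o)ᶜ}`
(`indicator_conn_eq`), the sum having exactly one nonzero term when `o ⟷_N x` without double
connection (`card_filter_isFirstPivotal`). This is the first step ((2.8)–(2.11)) of the proof of
Sakai's Proposition 1.1 (`IsingLace.Sakai2007_prop11`).

## References

* A. Sakai, *Lace expansion for the Ising model*, Comm. Math. Phys. 272 (2007) 283–344,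
  arXiv:math-ph/0510093, Definition 2.1 and (2.9) [Sakai2007].
-/

noncomputable section

open Finset
open Literature.Combinatorics.SimpleGraph

namespace Literature.Probability.LatticeModels

variable {V : Type*} [Fintype V] [DecidableEq V] {G : SimpleGraph V} [DecidableRel G.Adj]

namespace IsingLace

/-! ## The trace graph and the deletion of a bond -/

omit [DecidableEq V] in
/-- An edge of the trace graph is an edge of `G`. [folklore] -/
theorem adj_of_traceGraph_adj {N : Current G} {a b : V}
    (h : (Percolation.openGraph N.traced).Adj a b) : G.Adj a b := by
  rw [Percolation.openGraph_adj] at h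
  exact Current.traced_subset_edgeSet N h.1

/-- Setting `n_b = 0` removes `b` from the trace. [folklore] -/
theorem traced_update_zero (N : Current G) (e : G.edgeFinset) :
    Current.traced (Function.update N e 0) = N.traced \ {(e : Sym2 V)} := by
  ext f
  simp only [Current.traced, Set.mem_setOf_eq, Set.mem_sdiff, Set.mem_singleton_iff]
  constructor
  · rintro ⟨hf, hpos⟩
    have hne : (⟨f, hf⟩ : G.edgeFinset) ≠ e := by
      intro h
      rw [h, Function.update_self] at hpos
      exact lt_irrefl 0 hpos
    rw [Function.update_of_ne hne] at hpos
    exact ⟨⟨hf, hpos⟩, fun hfe => hne (Subtype.ext hfe)⟩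
  · rintro ⟨⟨hf, hpos⟩, hfe⟩
    have hne : (⟨f, hf⟩ : G.edgeFinset) ≠ e := fun h => hfe (congrArg Subtype.val h)
    refine ⟨hf, ?_⟩
    rw [Function.update_of_ne hne]
    exact hpos

/-- **Setting `n_b = 0` deletes the edge `b` from the trace graph.** [cite: Sakai2007, Definition 2.1 (ii)] -/
theorem openGraph_traced_update_zero (N : Current G) (e : G.edgeFinset) :
    Percolation.openGraph (Current.traced (Function.update N e 0)) =
      (Percolation.openGraph N.traced).deleteEdges {(e : Sym2 V)} := by
  ext a b
  rw [Percolation.openGraph_adj, SimpleGraph.deleteEdges_adj, Percolation.openGraph_adj,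
    traced_update_zero]
  simp only [Set.mem_sdiff, Set.mem_singleton_iff]
  tauto

/-- `x ⟷_N y off b` is reachability in the trace graph with `b` deleted. [cite: Sakai2007, Definition 2.1 (ii)] -/
theorem connOff_iff {N : Current G} {e : G.edgeFinset} {x y : V} :
    ConnOff G N e x y ↔ ((Percolation.openGraph N.traced).deleteEdges {(e : Sym2 V)}).Reachable x y := by
  rw [ConnOff, Conn, openGraph_traced_update_zero]

/-- **The cluster `𝒞^b_N(x)` is the `x`-side of `b` in the trace graph.** [cite: Sakai2007, Definition 2.1 (ii)] -/
theorem mem_clusterOff_iff {N : Current G} {e : G.edgeFinset} {x y : V} :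
    y ∈ clusterOff G N e x ↔ y ∈ sepSide (Percolation.openGraph N.traced) x (e : Sym2 V) := by
  rw [clusterOff_eq, Current.mem_cluster_iff, openGraph_traced_update_zero]
  rfl

/-! ## Connection avoiding a set = a walk of the trace graph off the set -/

omit [DecidableEq V] in
/-- Adjacency in the trace restricted to the bonds off `S`. [folklore] -/
theorem openGraph_tracedIn_offGraph_adj {N : Current G} {S : Finset V} {a b : V} :
    (Percolation.openGraph (N.tracedIn (offGraph G S))).Adj a b ↔
      (Percolation.openGraph N.traced).Adj a b ∧ a ∉ S ∧ b ∉ S := by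
  simp only [Percolation.openGraph_adj, Current.tracedIn, Set.mem_setOf_eq, mem_edgeSet_offGraph,
    Current.edgeOff_mk]
  constructor
  · rintro ⟨⟨⟨-, ha, hb⟩, ht⟩, hne⟩
    exact ⟨⟨ht, hne⟩, ha, hb⟩
  · rintro ⟨⟨ht, hne⟩, ha, hb⟩
    exact ⟨⟨⟨Current.traced_subset_edgeSet N ht, ha, hb⟩, ht⟩, hne⟩

omit [DecidableEq V] in
/-- **`w ⟷_N x in Sᶜ` iff `w, x ∉ S` and a walk of the trace graph from `w` to `x` stays off
`S`.** [cite: Sakai2007, Definition 2.1 (i)] -/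
theorem connAvoid_iff_exists_walk {N : Current G} {S : Finset V} {w x : V} :
    ConnAvoid G N S w x ↔ w ∉ S ∧ x ∉ S ∧
      ∃ q : (Percolation.openGraph N.traced).Walk w x, ∀ z ∈ q.support, z ∉ S := by
  rw [connAvoid_iff, Current.mem_connIn_iff]
  refine and_congr_right fun hw => and_congr_right fun hx => ⟨?_, ?_⟩
  · rintro ⟨q⟩
    -- every vertex of a walk in the restricted trace is off `S`
    induction q with
    | nil => exact ⟨SimpleGraph.Walk.nil, fun z hz => by
        rw [SimpleGraph.Walk.support_nil, List.mem_singleton] at hz; exact hz ▸ hw⟩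
    | @cons a b c hadj q ih =>
      have hab := openGraph_tracedIn_offGraph_adj.1 hadj
      obtain ⟨q', hq'⟩ := ih hab.2.2 hx
      refine ⟨SimpleGraph.Walk.cons hab.1 q', fun z hz => ?_⟩
      rw [SimpleGraph.Walk.support_cons, List.mem_cons] at hz
      rcases hz with rfl | hz
      · exact hw
      · exact hq' z hz
  · rintro ⟨q, hq⟩
    induction q with
    | nil => exact SimpleGraph.Reachable.refl _
    | @cons a b c hadj q ih =>
      have hb : b ∉ S := hq b (by simp)
      have h1 : (Percolation.openGraph (N.tracedIn (offGraph G S))).Adj a b :=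
        openGraph_tracedIn_offGraph_adj.2 ⟨hadj, hw, hb⟩
      exact h1.reachable.trans (ih hb hx fun z hz => hq z (by simp [hz]))

/-! ## Double connection is `2`-edge-reachability -/

/-- The directed bond of `G` under a directed bond of the trace graph. [folklore] -/
def dartOfTrace {N : Current G} (d : (Percolation.openGraph N.traced).Dart) : G.Dart :=
  ⟨d.toProd, adj_of_traceGraph_adj d.adj⟩

/-- A separating edge `s(u, w)` of the trace graph, oriented near-to-far, is a pivotal directed
bond for `o ⟷_N y` from `o`. [cite: Sakai2007, Definition 2.1 (iii)] -/
theorem isPivotal_of_sepEdge {N : Current G} {o y u w : V} (hadj : G.Adj u w)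
    (hsep : SepEdge (Percolation.openGraph N.traced) o y s(u, w))
    (hoy : (Percolation.openGraph N.traced).Reachable o y)
    (hu : u ∈ sepSide (Percolation.openGraph N.traced) o s(u, w)) :
    IsPivotal G N o y ⟨(u, w), hadj⟩ := by
  classical
  have hedge : ((dartEdge G ⟨(u, w), hadj⟩ : G.edgeFinset) : Sym2 V) = s(u, w) := rfl
  have hw : w ∉ sepSide (Percolation.openGraph N.traced) o s(u, w) := hsep.not_mem_side_of_mem hoy hu
  have hcl : ∀ z, z ∈ clusterOff G N (dartEdge G ⟨(u, w), hadj⟩) o ↔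
      z ∈ sepSide (Percolation.openGraph N.traced) o s(u, w) := fun z => by
    rw [mem_clusterOff_iff, hedge]
  refine ⟨?_, ?_⟩
  · show ConnOff G N (dartEdge G ⟨(u, w), hadj⟩) o u
    rw [connOff_iff, hedge]
    exact hu
  · show ConnAvoid G N (clusterOff G N (dartEdge G ⟨(u, w), hadj⟩) o) w y
    rw [connAvoid_iff_exists_walk]
    -- a walk of the trace graph from the far endpoint to `y`, off the side
    obtain ⟨p, hp⟩ := hoy.exists_isPath
    obtain ⟨d', hd', hd'e⟩ := hsep.exists_dart p
    obtain ⟨-, h2⟩ := hsep.dart_eq hp hd' hd'e hu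
    have hr := reachable_deleteEdges_snd_of_mem_darts hp hd'
    rw [hd'e, h2] at hr
    obtain ⟨q, hq⟩ := hsep.exists_walk_off_side hr
    exact ⟨fun h => hw ((hcl _).1 h), fun h => hsep.not_mem_side ((hcl _).1 h), q,
      fun z hz h => hq z hz ((hcl _).1 h)⟩

/-- **Double connection `x ⟺_N y` is `2`-edge-reachability in the trace graph** (no pivotal
directed bond iff no separating edge). [cite: Sakai2007, Definition 2.1 (iii)] -/
theorem isDoublyConn_iff {N : Current G} {o y : V} :
    IsDoublyConn G N o y ↔ (Percolation.openGraph N.traced).IsEdgeReachable 2 o y := by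
  classical
  constructor
  · rintro ⟨hconn, hnopiv⟩
    by_contra h2
    rw [SimpleGraph.isEdgeReachable_two] at h2
    push Not at h2
    obtain ⟨g, hg⟩ := h2
    have hsep : SepEdge (Percolation.openGraph N.traced) o y g := by
      refine ⟨?_, hg⟩
      by_contra hmem
      rw [SimpleGraph.deleteEdges_eq_self.2 (Set.disjoint_singleton_right.2 hmem)] at hg
      exact hg hconn
    obtain ⟨a, b, hgab, hadj, ha, -⟩ := hsep.exists_near_far hconn
    subst hgab
    exact hnopiv ⟨⟨(a, b), adj_of_traceGraph_adj hadj⟩,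
      isPivotal_of_sepEdge (adj_of_traceGraph_adj hadj) hsep hconn ha⟩
  · intro h2
    refine ⟨h2.reachable two_ne_zero, ?_⟩
    rintro ⟨d, -, havoid⟩
    have hy : y ∉ clusterOff G N (dartEdge G d) o := (connAvoid_iff_exists_walk.1 havoid).2.1
    rw [mem_clusterOff_iff] at hy
    exact hy ((SimpleGraph.isEdgeReachable_two.1 h2) _)

/-! ## The first pivotal bond and the decomposition (2.9) -/

variable (G) in
/-- The qualifying directed bonds of the first expansion step: `o ⟺_N b̲ off b`, `n_b > 0`, and
`b̄ ⟷_N x in 𝒞^b_N(o)ᶜ` ("if there is [a pivotal bond], we take the first bond among them").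
[cite: Sakai2007, (2.9)] -/
def IsFirstPivotal (N : Current G) (o x : V) (d : G.Dart) : Prop :=
  IsDoublyConn G (Function.update N (dartEdge G d) 0) o d.fst ∧ 0 < N (dartEdge G d) ∧
    ConnAvoid G N (clusterOff G N (dartEdge G d) o) d.snd x

/-- A qualifying bond carries current, so it is a directed bond of the trace graph. [folklore] -/
theorem IsFirstPivotal.traceAdj {N : Current G} {o x : V} {d : G.Dart} (h : IsFirstPivotal G N o x d) :
    (Percolation.openGraph N.traced).Adj d.fst d.snd := by
  rw [Percolation.openGraph_adj]
  exact ⟨(Current.mem_traced_iff N (dartEdge G d)).2 h.2.1, d.fst_ne_snd⟩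

/-- **The qualifying bonds are the first darts of the trace graph.** [cite: Sakai2007, (2.9)] -/
theorem isFirstPivotal_iff {N : Current G} {o x : V} {d : G.Dart} :
    IsFirstPivotal G N o x d ↔ ∃ hd : (Percolation.openGraph N.traced).Adj d.fst d.snd,
      IsFirstDart (Percolation.openGraph N.traced) o x ⟨(d.fst, d.snd), hd⟩ := by
  have hedge : ((dartEdge G d : G.edgeFinset) : Sym2 V) = s(d.fst, d.snd) := rfl
  have hcl : ∀ z, z ∈ clusterOff G N (dartEdge G d) o ↔
      z ∈ sepSide (Percolation.openGraph N.traced) o s(d.fst, d.snd) := fun z => by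
    rw [mem_clusterOff_iff, hedge]
  have hdc : ∀ hd : (Percolation.openGraph N.traced).Adj d.fst d.snd,
      IsFirstDart (Percolation.openGraph N.traced) o x ⟨(d.fst, d.snd), hd⟩ ↔
        ((Percolation.openGraph N.traced).deleteEdges {s(d.fst, d.snd)}).IsEdgeReachable 2 o d.fst ∧
          ∃ q : (Percolation.openGraph N.traced).Walk d.snd x,
            ∀ z ∈ q.support, z ∉ sepSide (Percolation.openGraph N.traced) o s(d.fst, d.snd) :=
    fun hd => Iff.rfl
  constructor
  · intro h
    refine ⟨h.traceAdj, (hdc _).2 ⟨?_, ?_⟩⟩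
    · have h1 := isDoublyConn_iff.1 h.1
      rwa [openGraph_traced_update_zero, hedge] at h1
    · obtain ⟨-, -, q, hq⟩ := connAvoid_iff_exists_walk.1 h.2.2
      exact ⟨q, fun z hz hside => hq z hz ((hcl z).2 hside)⟩
  · rintro ⟨hd, hfd⟩
    obtain ⟨h1, q, hq⟩ := (hdc hd).1 hfd
    refine ⟨?_, ?_, ?_⟩
    · rw [isDoublyConn_iff, openGraph_traced_update_zero, hedge]
      exact h1
    · exact (Current.mem_traced_iff N (dartEdge G d)).1 ((Percolation.openGraph_adj _ _ _).1 hd).1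
    · rw [connAvoid_iff_exists_walk]
      have hsep : SepEdge (Percolation.openGraph N.traced) o x s(d.fst, d.snd) := hfd.sepEdge
      have hfst : d.fst ∈ sepSide (Percolation.openGraph N.traced) o s(d.fst, d.snd) := hfd.fst_mem_side
      have hsnd := hsep.not_mem_side_of_mem hfd.reachable hfst
      exact ⟨fun h => hsnd ((hcl _).1 h), fun h => hsep.not_mem_side ((hcl _).1 h), q,
        fun z hz h => hq z hz ((hcl _).1 h)⟩

/-- At most one directed bond qualifies. [cite: Sakai2007, (2.9)] -/
theorem IsFirstPivotal.unique {N : Current G} {o x : V} {d d' : G.Dart} (h : IsFirstPivotal G N o x d)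
    (h' : IsFirstPivotal G N o x d') : d = d' := by
  obtain ⟨hd, hfd⟩ := isFirstPivotal_iff.1 h
  obtain ⟨hd', hfd'⟩ := isFirstPivotal_iff.1 h'
  have := hfd.unique hfd'
  rw [SimpleGraph.Dart.ext_iff] at this
  exact SimpleGraph.Dart.ext _ _ this

/-- A qualifying bond exists iff `o ⟷_N x` without double connection. [cite: Sakai2007, (2.9)] -/
theorem exists_isFirstPivotal_iff {N : Current G} {o x : V} :
    (∃ d : G.Dart, IsFirstPivotal G N o x d) ↔ Conn G N o x ∧ ¬IsDoublyConn G N o x := by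
  rw [isDoublyConn_iff, show Conn G N o x ↔ (Percolation.openGraph N.traced).Reachable o x from Iff.rfl,
    ← exists_isFirstDart_iff]
  constructor
  · rintro ⟨d, hd⟩
    obtain ⟨hadj, hfd⟩ := isFirstPivotal_iff.1 hd
    exact ⟨_, hfd⟩
  · rintro ⟨d, hfd⟩
    exact ⟨dartOfTrace d, isFirstPivotal_iff.2 ⟨d.adj, hfd⟩⟩

open Classical in
/-- **The first pivotal bond is unique**: the number of qualifying directed bonds is `1` if
`o ⟷_N x` without double connection and `0` otherwise. [cite: Sakai2007, (2.9)] -/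
theorem card_filter_isFirstPivotal (N : Current G) (o x : V) :
    (univ.filter (IsFirstPivotal G N o x)).card =
      if Conn G N o x ∧ ¬IsDoublyConn G N o x then 1 else 0 := by
  split_ifs with h
  · obtain ⟨d₀, hd₀⟩ := exists_isFirstPivotal_iff.2 h
    rw [Finset.card_eq_one]
    refine ⟨d₀, Finset.eq_singleton_iff_unique_mem.2 ⟨by simpa using hd₀, fun d hd => ?_⟩⟩
    exact IsFirstPivotal.unique (by simpa using hd) hd₀
  · rw [Finset.card_eq_zero, Finset.filter_eq_empty_iff]
    intro d _ hd
    exact h (exists_isFirstPivotal_iff.1 ⟨d, hd⟩)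

open Classical in
/-- **Sakai's decomposition (2.9) of the connection indicator by the first pivotal bond**:
`1{o ⟷_N x} = 1{o ⟺_N x} + Σ_b 1{o ⟺_N b̲ off b} 1{n_b > 0} 1{b̄ ⟷_N x in 𝒞^b_N(o)ᶜ}`.
[cite: Sakai2007, (2.9)] -/
theorem indicator_conn_eq (N : Current G) (o x : V) :
    (if Conn G N o x then (1 : ℝ) else 0) =
      (if IsDoublyConn G N o x then (1 : ℝ) else 0) +
        ∑ d : G.Dart, if IsFirstPivotal G N o x d then (1 : ℝ) else 0 := by
  rw [Finset.sum_boole, card_filter_isFirstPivotal]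
  by_cases hc : Conn G N o x
  · by_cases hd : IsDoublyConn G N o x
    · simp [hc, hd]
    · simp [hc, hd]
  · have hd : ¬IsDoublyConn G N o x := fun h => hc h.1
    simp [hc, hd]

end IsingLace

end Literature.Probability.LatticeModels

end
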